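import Literature.Analysis.FluidPDE.ElgindiPolarEnergy
import Literature.Analysis.FluidPDE.ElgindiOrthogonalMode
import Literature.Analysis.FluidPDE.ElgindiTransportL2Coercivity
import HarnessLib

/-!
# The `L²` angular estimate of the polar model operator ([Elgindi2021] Proposition 7.1, first half)

Topic `Literature/Analysis/FluidPDE`. Proof file (everything proved, no definitions, no named
facts) on the proof path of the named fact
`Literature.Analysis.FluidPDE.Elgindi.ElgindiGhoulMasmoudi2021_stabilityCore`
(`ElgindiStabilityDecomposition.lean`). T. M. Elgindi, Ann. of Math. 194 (2021) =
arXiv:1904.04795, §7.1 Proposition 7.1 and Step 2 of its proof (p. 19):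

> "**Proposition 7.1.** Let `F ∈ L²` be given and `0 < α ≤ 1`. Assume that for every `R` we have
> `∫₀^{π/2}F(R,θ)cos²(θ)sin(θ)dθ = 0.` Then, the unique `L²` solution to (PolarBSL) with Dirichlet
> boundary conditions on `[0,∞)×[0,π/2]` satisfies: `|∂_θ(Ψ/cosθ)|_{L²} + |∂_θθΨ|_{L²} +
> α²|R²∂_RRΨ|_{L²} ≤ 100|F|_{L²}`." … (Step 2) "In particular, since `0 < α ≤ 1` we have:
> `|∂_θΨ|² − 6|Ψ|² ≤ |F|_{L²}|Ψ|_{L²}` … Thus, `Σ_{n≥1}4n²|Ψ_n(R)|² ≤ 4|F||Ψ|_{L²}`. In particular,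
> `|∂_θΨ|_{L²} ≤ 4|F|_{L²}`. At this point we are done and the rest is standard".

The a-priori form of this first half, for the class `Ψ = cosθ·χ`, `χ ∈ C²(ℝ²)` compactly supported
with `χ(R,0) = 0`, `F := L(Ψ)` (`ellipticOp`): if `∫₀^{π/2}F(R,θ)K(θ)dθ = 0` for all `R > 0`
(`K = 3sinθcos²θ`), then
* `12‖Ψ‖² ≤ ‖∂_θΨ‖²` (`integral_strip_sq_le_sq_dθ`: Step 1 `Ψ ⊥ sinθcos²θ` slice-wise
  (`kMoment_eq_zero_of_ellipticOp_orthogonal`) and the constrained Poincaré inequality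
  (`orthogonalMode_poincare`) on every slice, integrated in `R`);
* `‖∂_θΨ‖² ≤ ⅓‖F‖²` and `‖Ψ‖² ≤ ‖F‖²/36` for `0 < α ≤ 1` (`integral_strip_sq_dθ_le`,
  `integral_strip_sq_le`: the energy identity `integral_strip_ellipticOp_mul_self`, whose radial and
  `sec`-terms are nonnegative, and Cauchy–Schwarz), sharper than the printed `|∂_θΨ| ≤ 4|F|`.
All norms are in `L²(dRdθ)` of the open strip.
-/

noncomputable section

open MeasureTheory Set Real Filter Function intervalIntegral
open _root_.Topology

namespace Literature.Analysis.FluidPDE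

namespace Elgindi

/-- **`12‖Ψ‖² ≤ ‖∂_θΨ‖²` for profiles orthogonal to the adjoint mode** (Step 1 + the constrained
Poincaré inequality, slice by slice). [cite: Elgindi2021, §7.1 proof of Proposition 7.1, Steps 1–2 (p. 19 of arXiv:1904.04795)] -/
theorem integral_strip_sq_le_sq_dθ {α : ℝ} (hα : 0 < α) {χ : ℝ → ℝ → ℝ} (hχ : ContDiff ℝ 2 (uncurry χ))
    (hs : HasCompactSupport (uncurry χ)) (hχ0 : ∀ R, χ R 0 = 0) {Ψ : ℝ → ℝ → ℝ}
    (hΨ : Ψ = fun R θ => Real.cos θ * χ R θ)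
    (horth : ∀ R, 0 < R → ∫ θ in Ioo 0 (π / 2), ellipticOp α Ψ R θ * kernelK θ = 0) :
    12 * (∫ p in strip, Ψ p.1 p.2 ^ 2) ≤ ∫ p in strip, dθ Ψ p.1 p.2 ^ 2 := by
  have hΨ2 : ContDiff ℝ 2 (uncurry Ψ) := by rw [hΨ]; exact contDiff_cosProfile hχ
  have hΨs : HasCompactSupport (uncurry Ψ) := by rw [hΨ]; exact hasCompactSupport_cosProfile hs
  have hdθΨ : ContDiff ℝ 1 (uncurry (dθ Ψ)) := contDiff_dθ_of_contDiff (n := 1) hΨ2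
  have hdθΨs : HasCompactSupport (uncurry (dθ Ψ)) := hasCompactSupport_dθ_of hΨs
  have hD0 : ∀ R, Ψ R 0 = 0 := fun R => by rw [hΨ]; simp [hχ0 R]
  have hD1 : ∀ R, Ψ R (π / 2) = 0 := fun R => by rw [hΨ]; simp
  -- Step 1: `Ψ(R,·) ⊥ K` for `R > 0`
  have hK := kMoment_eq_zero_of_ellipticOp_orthogonal hα hΨ2 hΨs hD0 hD1 horth
  -- plane integrability of `Ψ²` and `(∂_θΨ)²`
  have cΨ : Continuous fun p : ℝ × ℝ => Ψ p.1 p.2 := hΨ2.continuous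
  have cdθ : Continuous fun p : ℝ × ℝ => dθ Ψ p.1 p.2 := hdθΨ.continuous
  have sE : HasCompactSupport fun p : ℝ × ℝ => Ψ p.1 p.2 ^ 2 := by
    have : (fun p : ℝ × ℝ => Ψ p.1 p.2 ^ 2) = fun p : ℝ × ℝ => Ψ p.1 p.2 * Ψ p.1 p.2 := by funext p; ring
    rw [this]; exact hΨs.mul_left
  have sY : HasCompactSupport fun p : ℝ × ℝ => dθ Ψ p.1 p.2 ^ 2 := by
    have : (fun p : ℝ × ℝ => dθ Ψ p.1 p.2 ^ 2) = fun p : ℝ × ℝ => dθ Ψ p.1 p.2 * dθ Ψ p.1 p.2 := by funext p; ring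
    rw [this]; exact hdθΨs.mul_left
  have iE : Integrable fun p : ℝ × ℝ => Ψ p.1 p.2 ^ 2 := (cΨ.pow 2).integrable_of_hasCompactSupport sE
  have iY : Integrable fun p : ℝ × ℝ => dθ Ψ p.1 p.2 ^ 2 := (cdθ.pow 2).integrable_of_hasCompactSupport sY
  have iG : Integrable fun p : ℝ × ℝ => dθ Ψ p.1 p.2 ^ 2 - 12 * Ψ p.1 p.2 ^ 2 := iY.sub (iE.const_mul _)
  -- slice-wise Poincaré
  have hslice : ∀ R ∈ Ioi (0 : ℝ), 0 ≤ ∫ θ in Ioo 0 (π / 2), (dθ Ψ R θ ^ 2 - 12 * Ψ R θ ^ 2) := by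
    intro R hR
    have huR : ContDiff ℝ 1 fun θ => Ψ R θ := (hΨ2.comp (contDiff_const.prodMk contDiff_id)).of_le (by norm_num)
    have hdu : deriv (fun θ => Ψ R θ) = fun θ => dθ Ψ R θ := rfl
    have horthR : ∫ x in (0 : ℝ)..(π / 2), Ψ R x * (Real.sin x * Real.cos x ^ 2) = 0 := by
      have h := hK R hR
      rw [kMoment_def] at h
      have e : ∫ θ in Ioo 0 (π / 2), Ψ R θ * kernelK θ = 3 * ∫ θ in Ioo 0 (π / 2), Ψ R θ * (Real.sin θ * Real.cos θ ^ 2) := by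
        rw [← MeasureTheory.integral_const_mul]
        refine setIntegral_congr_fun measurableSet_Ioo fun θ _ => ?_
        unfold kernelK; ring
      rw [e] at h
      rw [intervalIntegral.integral_of_le (by positivity), integral_Ioc_eq_integral_Ioo]
      linarith
    have hP := orthogonalMode_poincare huR (hD0 R) (hD1 R) horthR
    rw [hdu] at hP
    rw [intervalIntegral.integral_of_le (by positivity), intervalIntegral.integral_of_le (by positivity),
      integral_Ioc_eq_integral_Ioo, integral_Ioc_eq_integral_Ioo] at hP
    have cu : Continuous fun θ => Ψ R θ := cΨ.comp (Continuous.prodMk_right R)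
    have cdu : Continuous fun θ => dθ Ψ R θ := cdθ.comp (Continuous.prodMk_right R)
    have j1 : IntegrableOn (fun θ => dθ Ψ R θ ^ 2) (Ioo 0 (π / 2)) :=
      ((cdu.pow 2).continuousOn.integrableOn_Icc (a := 0) (b := π / 2)).mono_set Ioo_subset_Icc_self
    have j2 : IntegrableOn (fun θ => 12 * Ψ R θ ^ 2) (Ioo 0 (π / 2)) :=
      (((cu.pow 2).const_mul _).continuousOn.integrableOn_Icc (a := 0) (b := π / 2)).mono_set Ioo_subset_Icc_self
    rw [integral_sub j1 j2, MeasureTheory.integral_const_mul]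
    simp only at hP
    linarith
  have h0 : 0 ≤ ∫ p in strip, (dθ Ψ p.1 p.2 ^ 2 - 12 * Ψ p.1 p.2 ^ 2) := by
    rw [integral_strip_eq_integral_Ioi_integral_Ioo iG]
    exact setIntegral_nonneg measurableSet_Ioi hslice
  have k2 : IntegrableOn (fun p : ℝ × ℝ => 12 * Ψ p.1 p.2 ^ 2) strip := (iE.const_mul _).integrableOn
  rw [integral_sub iY.integrableOn k2, MeasureTheory.integral_const_mul] at h0
  linarith

/-- **`‖∂_θΨ‖² ≤ ⅓‖L(Ψ)‖²` and `‖Ψ‖² ≤ ‖L(Ψ)‖²/36`** (Proposition 7.1, the angular first-order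
part, a-priori form for the class `Ψ = cosθ·χ`, `0 < α ≤ 1`). [cite: Elgindi2021, §7.1 Proposition 7.1 and Step 2 of its proof ("|∂_θΨ|_{L²} ≤ 4|F|_{L²}") (p. 19 of arXiv:1904.04795)] -/
theorem integral_strip_sq_dθ_le {α : ℝ} (hα : 0 < α) (hα1 : α ≤ 1) {χ : ℝ → ℝ → ℝ} (hχ : ContDiff ℝ 2 (uncurry χ))
    (hs : HasCompactSupport (uncurry χ)) (hχ0 : ∀ R, χ R 0 = 0) {Ψ : ℝ → ℝ → ℝ}
    (hΨ : Ψ = fun R θ => Real.cos θ * χ R θ)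
    (horth : ∀ R, 0 < R → ∫ θ in Ioo 0 (π / 2), ellipticOp α Ψ R θ * kernelK θ = 0) :
    (∫ p in strip, dθ Ψ p.1 p.2 ^ 2) ≤ (1 / 3) * ∫ p in strip, ellipticOp α Ψ p.1 p.2 ^ 2 ∧
      (∫ p in strip, Ψ p.1 p.2 ^ 2) ≤ (1 / 36) * ∫ p in strip, ellipticOp α Ψ p.1 p.2 ^ 2 := by
  have hχ1 : ContDiff ℝ 1 (uncurry χ) := hχ.of_le (by norm_num)
  have hΨ2 : ContDiff ℝ 2 (uncurry Ψ) := by rw [hΨ]; exact contDiff_cosProfile hχ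
  have hΨs : HasCompactSupport (uncurry Ψ) := by rw [hΨ]; exact hasCompactSupport_cosProfile hs
  have hdzΨ : ContDiff ℝ 1 (uncurry (dz Ψ)) := contDiff_dz_of_contDiff (n := 1) hΨ2
  have hdθΨ : ContDiff ℝ 1 (uncurry (dθ Ψ)) := contDiff_dθ_of_contDiff (n := 1) hΨ2
  have hdθχ : ContDiff ℝ 1 (uncurry (dθ χ)) := contDiff_dθ_of_contDiff (n := 1) hχ
  have cΨ : Continuous fun p : ℝ × ℝ => Ψ p.1 p.2 := hΨ2.continuous
  have cχ : Continuous fun p : ℝ × ℝ => χ p.1 p.2 := hχ.continuous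
  have cdz : Continuous fun p : ℝ × ℝ => dz Ψ p.1 p.2 := hdzΨ.continuous
  have cdz2 : Continuous fun p : ℝ × ℝ => dz (dz Ψ) p.1 p.2 := continuous_dz hdzΨ
  have cdθ : Continuous fun p : ℝ × ℝ => dθ Ψ p.1 p.2 := hdθΨ.continuous
  have cdθ2 : Continuous fun p : ℝ × ℝ => dθ (dθ Ψ) p.1 p.2 := (contDiff_dθ_of_contDiff (n := 0) hdθΨ).continuous
  have cdθχ : Continuous fun p : ℝ × ℝ => dθ χ p.1 p.2 := hdθχ.continuous
  -- the two inequalities from the previous theorem and the energy identity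
  have hP := integral_strip_sq_le_sq_dθ hα hχ hs hχ0 hΨ horth
  have hE := integral_strip_ellipticOp_mul_self α hχ hs hχ0 hΨ
  -- a continuous compactly supported representative of `L(Ψ)` on the strip
  set G : ℝ × ℝ → ℝ := fun p => -α ^ 2 * p.1 ^ 2 * dz (dz Ψ) p.1 p.2 - α * (5 + α) * p.1 * dz Ψ p.1 p.2 -
    dθ (dθ Ψ) p.1 p.2 + (Real.cos p.2 * χ p.1 p.2 + Real.sin p.2 * dθ χ p.1 p.2) - 6 * Ψ p.1 p.2 with hG
  have cG : Continuous G := by simp only [hG]; fun_prop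
  have hGeq : ∀ p ∈ strip, ellipticOp α Ψ p.1 p.2 = G p := by
    intro p hp
    have hcos : Real.cos p.2 ≠ 0 := (Real.cos_pos_of_mem_Ioo ⟨by linarith [hp.2.1, Real.pi_pos], hp.2.2⟩).ne'
    have hT : Real.cos p.2 * χ p.1 p.2 / Real.cos p.2 ^ 2 +
        Real.sin p.2 * (-Real.sin p.2 * χ p.1 p.2 + Real.cos p.2 * dθ χ p.1 p.2) / Real.cos p.2 =
        Real.cos p.2 * χ p.1 p.2 + Real.sin p.2 * dθ χ p.1 p.2 := by
      rw [div_add_div _ _ (pow_ne_zero 2 hcos) hcos, div_eq_iff (mul_ne_zero (pow_ne_zero 2 hcos) hcos)]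
      have := Real.sin_sq_add_cos_sq p.2
      linear_combination (-(Real.cos p.2 ^ 2 * χ p.1 p.2)) * this
    have hΨp : Ψ p.1 p.2 / Real.cos p.2 ^ 2 = Real.cos p.2 * χ p.1 p.2 / Real.cos p.2 ^ 2 := by rw [hΨ]
    have hdθp : dθ Ψ p.1 p.2 = -Real.sin p.2 * χ p.1 p.2 + Real.cos p.2 * dθ χ p.1 p.2 := by
      rw [hΨ, dθ_cosProfile hχ1]
    have hud : DifferentiableAt ℝ (fun θ' => Ψ p.1 θ') p.2 :=
      ((hΨ2.comp (contDiff_const.prodMk contDiff_id)).differentiable (by simp)) p.2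
    rw [ellipticOp_eq_expanded α hud hcos, hdθp, hΨp, hT]
  -- integrability on the strip
  have sΨ : HasCompactSupport fun p : ℝ × ℝ => Ψ p.1 p.2 := hΨs
  have sE : HasCompactSupport fun p : ℝ × ℝ => Ψ p.1 p.2 ^ 2 := by
    have : (fun p : ℝ × ℝ => Ψ p.1 p.2 ^ 2) = fun p : ℝ × ℝ => Ψ p.1 p.2 * Ψ p.1 p.2 := by funext p; ring
    rw [this]; exact hΨs.mul_left
  have iE : Integrable fun p : ℝ × ℝ => Ψ p.1 p.2 ^ 2 := (cΨ.pow 2).integrable_of_hasCompactSupport sE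
  have iGΨ : Integrable fun p : ℝ × ℝ => G p * Ψ p.1 p.2 := (cG.mul cΨ).integrable_of_hasCompactSupport sΨ.mul_left
  -- `G` is compactly supported (every term carries a factor supported in `tsupport χ`), so `G²` is integrable
  have hTΨ : tsupport (uncurry Ψ) ⊆ tsupport (uncurry χ) := by
    have e : uncurry Ψ = (fun p : ℝ × ℝ => Real.cos p.2) * uncurry χ := by rw [hΨ]; funext p; rfl
    rw [e]; exact tsupport_mul_subset_right
  have hGs : HasCompactSupport G := by
    refine HasCompactSupport.of_support_subset_isCompact hs.isCompact fun p hp => ?_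
    by_contra hT
    have h1 : χ p.1 p.2 = 0 := image_eq_zero_of_notMem_tsupport (f := uncurry χ) hT
    have h2 : Ψ p.1 p.2 = 0 := image_eq_zero_of_notMem_tsupport (f := uncurry Ψ) fun h => hT (hTΨ h)
    have h3 : dθ χ p.1 p.2 = 0 := image_eq_zero_of_notMem_tsupport (f := uncurry (dθ χ)) fun h => hT (tsupport_dθ_subset' χ h)
    have h4 : dz Ψ p.1 p.2 = 0 := image_eq_zero_of_notMem_tsupport (f := uncurry (dz Ψ)) fun h => hT (hTΨ (tsupport_dz_subset h))
    have h5 : dz (dz Ψ) p.1 p.2 = 0 := image_eq_zero_of_notMem_tsupport (f := uncurry (dz (dz Ψ))) fun h =>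
      hT (hTΨ (tsupport_dz_subset (tsupport_dz_subset h)))
    have h6 : dθ (dθ Ψ) p.1 p.2 = 0 := image_eq_zero_of_notMem_tsupport (f := uncurry (dθ (dθ Ψ))) fun h =>
      hT (hTΨ (tsupport_dθ_subset' Ψ (tsupport_dθ_subset' (dθ Ψ) h)))
    apply hp
    simp [hG, h1, h2, h3, h4, h5, h6]
  have sG2 : HasCompactSupport fun p : ℝ × ℝ => G p ^ 2 := by
    have e : (fun p : ℝ × ℝ => G p ^ 2) = fun p => G p * G p := by funext p; ring
    rw [e]; exact hGs.mul_left
  have iG2 : IntegrableOn (fun p : ℝ × ℝ => G p ^ 2) strip := ((cG.pow 2).integrable_of_hasCompactSupport sG2).integrableOn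
  -- Cauchy–Schwarz on the strip
  have hCS := sq_integral_mul_le (μ := volume.restrict strip) iG2 iE.integrableOn iGΨ.integrableOn
  have eL : ∫ p in strip, ellipticOp α Ψ p.1 p.2 * Ψ p.1 p.2 = ∫ p in strip, G p * Ψ p.1 p.2 :=
    setIntegral_congr_fun measurableSet_strip fun p hp => by rw [hGeq p hp]
  have eL2 : ∫ p in strip, ellipticOp α Ψ p.1 p.2 ^ 2 = ∫ p in strip, G p ^ 2 :=
    setIntegral_congr_fun measurableSet_strip fun p hp => by rw [hGeq p hp]
  -- the energy identity gives `½‖Ψ_θ‖² ≤ ⟨LΨ,Ψ⟩`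
  have hZ : 0 ≤ ∫ p in strip, (p.1 * dz Ψ p.1 p.2) ^ 2 := integral_nonneg fun p => sq_nonneg _
  have hX : 0 ≤ ∫ p in strip, χ p.1 p.2 ^ 2 := integral_nonneg fun p => sq_nonneg _
  have hEn : 0 ≤ ∫ p in strip, Ψ p.1 p.2 ^ 2 := integral_nonneg fun p => sq_nonneg _
  have hY : 0 ≤ ∫ p in strip, dθ Ψ p.1 p.2 ^ 2 := integral_nonneg fun p => sq_nonneg _
  have hL2 : 0 ≤ ∫ p in strip, G p ^ 2 := integral_nonneg fun p => sq_nonneg _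
  have hcoef : 0 ≤ α * (5 + α) / 2 - α ^ 2 := by nlinarith
  have hlow : (1 / 2) * (∫ p in strip, dθ Ψ p.1 p.2 ^ 2) ≤ ∫ p in strip, G p * Ψ p.1 p.2 := by
    rw [← eL, hE]
    nlinarith [mul_nonneg hcoef hEn, mul_nonneg (sq_nonneg α) hZ]
  rw [eL2]
  -- `(½Y)² ≤ ⟨LΨ,Ψ⟩² ≤ ‖G‖²‖Ψ‖² ≤ ‖G‖² Y/12`
  set Y := ∫ p in strip, dθ Ψ p.1 p.2 ^ 2 with hYdef
  set L2 := ∫ p in strip, G p ^ 2 with hL2def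
  set X := ∫ p in strip, Ψ p.1 p.2 ^ 2 with hXdef
  have h1 : ((1 / 2) * Y) ^ 2 ≤ L2 * X := by
    calc ((1 / 2) * Y) ^ 2 ≤ (∫ p in strip, G p * Ψ p.1 p.2) ^ 2 := pow_le_pow_left₀ (by positivity) hlow 2
      _ ≤ L2 * X := hCS
  have h2 : ((1 / 2) * Y) ^ 2 ≤ L2 * (Y / 12) := h1.trans (mul_le_mul_of_nonneg_left (by linarith) hL2)
  have hYle : Y ≤ (1 / 3) * L2 := by
    by_contra hlt
    have hlt' : (1 / 3) * L2 < Y := not_le.1 hlt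
    have hYpos : 0 < Y := lt_of_le_of_lt (by positivity) hlt'
    nlinarith
  exact ⟨hYle, by linarith⟩

end Elgindi

end Literature.Analysis.FluidPDE
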